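import Literature.MathematicalPhysics.QuantumFieldTheory.Balaban1983to89.Node00.CarriersB8SubBP2D
import Literature.MathematicalPhysics.QuantumFieldTheory.Balaban1983to89.B8Prop5LandauDataZd

/-!
# NODE 00 (YM-PLAN Track A) — «THE P₅-PIN»: PROPOSITION 5's CARRIERS OF THE CUT RESIDUAL LAYER PINNED TO PRINT'S FAMILY —
# `IdxB8LanC θ` (Prop. 5's index of record: a (1.5)-OBEYING ADMISSIBLE member `j : IdxB8SubD θ` (`Node00/CarriersB8SubD`) together with a UNITARY background `U₀` on `ℤ^{θ.D}`, print p. 94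
# «for `U₀ ∈ 𝔄_k({Ω_j}, α₀)`» — the restriction to `𝔄_k` is Proposition 5's HYPOTHESIS (1.33), read inside the member's `Hyp169`, not a restriction of the index),
# its reading `IdxB8LanC.toZdLanIdx` as a `B8Prop5LandauDataZd.ZdLanIdx`, the members of record `lanOfRecordSubC θ B₁ := zdLan θ.L B₁ ∘ toZdLanIdx`, and the pinned
# cut layer `ResidB8.cutSubBP₅ λ c₁ ρ₀ := λ.cutSubBP (IdxB8LanC θ) (fun a => zdLan θ.L λ.B₁ a.toZdLanIdx) c₁ ρ₀`; `rfl` faces; the `ι`-law faces in the knits' letters;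
# honesty both ways; the «P₂D» slot `B8LeafOfRecordSubBP₂D` read at the pin (definitions + `rfl` ∕ `Iff.rfl` bookkeeping only)

[Balaban1985RegularSpaces] = T. Bałaban, *Spaces of regular gauge field configurations on a lattice and gauge fixing conditions*, Commun. Math. Phys. **99**
(1985) 75–102 — Prop. 5 p. 94 ((1.107)–(1.109); «Let us consider the equations (1.107) for `U₀ ∈ 𝔄_k({Ω_j}, α₀)` and `U₁` satisfying (1.69), (1.68) …»), (1.3)–(1.5)
p. 77, (1.33) p. 82, (1.68)–(1.69) p. 88, (1.73)–(1.74) pp. 88–89, (1.102) p. 93, Thm 2 p. 83 («There exist constants B₁, B₂(β₀), c₁»), Prop. 6 p. 99.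
PDF held: `paper:balaban1985-cmp99-regular-spaces-gauge-fixing` (journal page = PDF page + 74).

NODE 00 CARRIER MODULE (width seat `pub-ymgap-dag-n05-w1` g2, 2026-08-28; the piece LOCATED by dag-n05-d g12 as NARROWNESS №5 of the ∃λ currency, cell bus
2026-08-28 06:40Z, and worded to «dag-n05-e ∕ node00-def lineage ∕ dag-n05-w1»).  APPEND-ONLY: a NEW importing module; NOTHING in `Node00/CarriersB8SubBPCutP` (dag-n05-e:
`ResidB8.cutSubBP`), `Node00/CarriersB8SubD` ∕ `CarriersB8SubBP2D` ∕ `CarriersB8SubBP2C` (this seat: `IdxB8SubD ⊂ IdxB8SubC`, `B8LeafOfRecordSubBP₂D`, `B8LeafOfRecordSubBP₂C`), `Node00/CarriersB8SubB` (dag-n05-d: `ResidB8.cutSubB`),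
`B8Prop5LandauDataZd` (dag-n05-b: `ZdLanIdx`, `zdLan`) or below them is edited — everything CONSUMED BY NAME.

WHY.  The cut layer the N05 knits of record conclude at, `λ.cutSubBP J lan c₁ ρ₀` (and dag-n05-d's `λ.cutSubB J lan c₁`), leaves Proposition 5's index `J` and members
`lan : J → B8.LandauData` to the CALLER; the slot `B8LeafOfRecordSubBP₂D θ (λ.cutSubBP J lan c₁ ρ₀)` (and its P₂C predecessor) reads Proposition 5's two conjuncts `B8.Prop5Exists λ.inp.B₀′ λ.B₁ lan ∧
B8.Prop5Unique lan` over THAT `J` — so the ∃-form «`∃ lam8, B8LeafOfRecordSubBP₂C θ lam8`» is inhabitable with `J := PEmpty` as far as Proposition 5 goes (dag-n05-d g12's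
LOCATED NARROWNESS №5: junk inhabitation of a typed conjunct, FLAG №7 theme).  Print's family is fixed (p. 94): the Landau-gauge problem (1.107) at EVERY background
`U₀ ∈ 𝔄_k({Ω_j}, α₀)` of EVERY admitted sequence of domains.  In the tree that family is dag-n05-b's `zdLan θ.L B₁ ⟨η, k, Ω, Λ_k, U₀⟩` (`B8Prop5LandauDataZd`, the (1.33) ∧
(1.69) ∧ (1.68) ∧ (1.73)–(1.74) hypothesis INSIDE the member's `Hyp169`), read at the geometry of every admissible collar-law member whose top constraint family reads print's (1.5) — `j : IdxB8SubD θ`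
(`Ω₀ = ℤᵈ`, the four located laws, (1.3)–(1.4) `DomainSeq`, (1.5) `Lˡ•z ∈ Lam L Ω l`; WITHOUT (1.5) the family would be WIDER than print's and [4]'s letters unsatisfiable over it —
this seat's certificate `B8SockLettersRDIdxB8LawsBVacuity`, p613168; dag-n05-c g15's DESIGN WORD) — and every unitary `U₀`.  THIS MODULE pins the cut layer's Prop-5 carriers to exactly that family: after it,
`B8LeafOfRecordSubBP₂D θ (λ.cutSubBP₅ c₁ ρ₀)` (dag-n05-d's «P₂D» slot over the (1.5)-obeying sub-index, `Node00/CarriersB8SubBP2D`) displays Proposition 5 over print's family and NOTHING wider or narrower, with no `∃` over the Prop-5 carriers left to a consumer.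
The pinned layer is LITERALLY the layer of dag-n05-d's knit p606531 ∕ p609803 (`lam.cutSubBP J (fun a => zdLan θ.L lam.B₁ (ι a)) c₁ ρ₀`) at `J := IdxB8LanC θ`,
`ι := IdxB8LanC.toZdLanIdx`, and the three `ι`-LAW binders those knits display (`hΩ0L`, `hΩL`, `htowerL`) are THEOREMS at this `ι` (§1) — so a knit at the pin is the generic
knit with three binders discharged by name.

WHAT IS DEFINED ∕ PROVED (kernel bookkeeping, 0 sorry, no estimate).
§1 `IdxB8LanC θ` (structure: `mem : IdxB8SubD θ`, `U₀`, `hU₀`), `nonempty_idxB8LanC`, `IdxB8LanC.toZdLanIdx` + `rfl` field faces, the `ι`-LAW FACES `IdxB8LanC.hΩ0L ∕ hΩL ∕ htowerL ∕ hlamTop`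
(letters of p606531's binders) + `IdxB8LanC.lawsB ∕ domainSeq`, `lanOfRecordSubC θ B₁` (Prop. 5's members of record) + `lanOfRecordSubC_apply`.
§2 `ResidB8.cutSubBP₅ λ c₁ ρ₀` + `cutSubBP₅_eq_cutSubBP` (`rfl`: the generic cut at `(IdxB8LanC θ, zdLan ∘ toZdLanIdx)`), field faces (`_I8c ∕ _lan ∕ _lan_apply ∕ _I8d ∕ _cub ∕ _c₁ ∕
_consts ∕ _toAxial`), HONESTY BOTH WAYS: `cutSubBP₅_lan_apply` (every Prop-5 member IS print's datum at an admissible member and a unitary background — no junk member) and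
★ `exists_mem_cutSubBP₅_lan_eq_zdLan` (EVERY such datum is a member — dag-n05-d's E4 certificate text, here by `rfl`).
§3 the «P₂D» slot at the pin: `b8LeafOfRecordSubBP₂D_cutSubBP₅_iff_cutSubBP` (`Iff.rfl` transfer from the generic cut), `b8LeafOfRecordSubBP₂D_cutSubBP₅_iff_classFree_and_P₂D` (the
reading: Prop. 5's conjuncts over `lanOfRecordSubC θ λ.B₁`, Prop. 6 at the print cubes `zdCubP … ρ₀`, t2 ∕ p3 ∕ t4 ∕ p7 ∕ t8 at the δ₂-members), `prop5_cutSubBP₅_reads`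
(the two Prop-5 conjuncts, member by member, ARE print's sentences at `zdLan θ.L λ.B₁ ⟨j, U₀⟩` — `Iff.rfl`), `b8LeafOfRecordSubBP₂D_cutSubBP₅_of_fields` (eight binders).
HONEST FRAMING: three definitions (an index, its reading map ∕ members, a named instance of dag-n05-e's cut) and `rfl` bookkeeping — nothing of [Balaban1985RegularSpaces]
Proposition 5 is asserted or discharged here; the pin only fixes WHICH family the slot's Prop-5 conjuncts speak about (print's); whether the record's ∃-currency names
`cutSubBP₅` is dag-n05-d's ∕ the planners' call, not this file's; N05 NOT discharged; counts unmoved; count-neutral; one finite T⁴ programme at fixed ε, Bałaban AS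
PRINTED — NOT continuum ∕ ℝ⁴ ∕ infinite volume ∕ OS ∕ mass gap ∕ Clay.  No `sorry`, no `axiom`, no `opaque`, no `instance`, no `notation`.  Unit `pub-ymgap-dag-n05-w1` (g2). -/

noncomputable section

namespace Literature.MathematicalPhysics.QuantumFieldTheory.Balaban1983to89.Node00

open DagBinding
open B8LeafKnitRS (B8LeafRS)
open B8LeafKnitRSC (B8LeafRSC)
open B8LeafModelZd (ZdIdx)
open B8LeafModelZd3P2 (zdGF3P₂ zdGF3HP₂)
open B8Lemma1NonAbelian (blockPairNA)
open B8IdxB8LawsB (IdxB8LawsB IdxB8SubB)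
open B8ConstraintBonds (DomainSeq Lam)
open B8Prop5LandauDataZd (ZdLanIdx zdLan)
open B8Prop7TowerAxialRecord (toAxialTowerResid)
open B7Prop2Explicit (unitaryUnits)
open B7Prop1Local (InBox)
open B8Ineq130 (tlo thi)

/-! ## §1. Proposition 5's index of record over the admissible sub-index, its `ZdLanIdx` reading, the `ι`-law faces, the members of record -/

section IndexP5

variable (θ : Stage3Params)

/-- **PROPOSITION 5's INDEX OF RECORD** at NODE 00's objects: a (1.5)-OBEYING ADMISSIBLE collar-law member `mem : IdxB8SubD θ` (`Ω₀ = ℤᵈ`, n05-c's four located laws, print's (1.5) on the top family, print's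
(1.3)–(1.4) `DomainSeq`) together with a UNITARY background `U₀` on the bonds of `ℤ^{θ.D}` — print p. 94 «Let us consider the equations (1.107) for `U₀ ∈ 𝔄_k({Ω_j}, α₀)`»
(the restriction to `𝔄_k` is the member's hypothesis (1.33) inside `zdLan`'s `Hyp169`, not a restriction of the index; p. 89 «We fix a configuration U₀»).
[cite: Balaban1985RegularSpaces, Prop. 5 p.94, (1.3)–(1.5) p.77, (1.33) p.82, p.89 (first sentence of Sect. D)] -/
structure IdxB8LanC where
  /-- the admissible collar-law member whose top constraint family reads (1.5) (geometry `η, k, {Ω_j}, {Λ_j}` with the laws of record) -/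
  mem : IdxB8SubD θ
  /-- the fixed unitary background `U₀` on the bonds of `ℤ^{θ.D}` -/
  U₀ : B7Prop1Explicit.Site θ.D → Fin θ.D → θ.𝔸ˣ
  hU₀ : ∀ x κ, U₀ x κ ∈ unitaryUnits θ.𝔸

/-- The index of record is inhabited at every `θ` (a (1.5)-obeying admissible member exists — `nonempty_idxB8SubD`, print's nested tower — and `U₀ := 1` is unitary).
[cite: Balaban1985RegularSpaces, Prop. 5 p.94, (1.3)–(1.4) p.77 (bookkeeping)] -/
theorem nonempty_idxB8LanC : Nonempty (IdxB8LanC θ) := by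
  obtain ⟨j⟩ := nonempty_idxB8SubD θ
  exact ⟨⟨j, fun _ _ => 1, fun _ _ => Subgroup.one_mem _⟩⟩

variable {θ}

/-- **The `ZdLanIdx` READING of an index of record**: spacing `η`, `k ≥ 1` levels, the domain sequence `{Ω_j}`, the TOP constraint sets `Λ_j := Λs k j` of the member, and
the background `U₀` — the argument at which dag-n05-b's `zdLan θ.L B₁` is Proposition 5's datum. [cite: Balaban1985RegularSpaces, (1.3)–(1.5) p.77, (1.29) p.81, p.89, Prop. 5 p.94] -/
def IdxB8LanC.toZdLanIdx (a : IdxB8LanC θ) : ZdLanIdx θ.D θ.𝔸 :=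
  ⟨a.mem.1.1.1.1.η, a.mem.1.1.1.1.hη, a.mem.1.1.1.1.k, a.mem.1.1.1.1.hk, a.mem.1.1.1.1.Ω, a.mem.1.1.1.1.Λs a.mem.1.1.1.1.k, a.U₀, a.hU₀⟩

/-- Field faces of the reading (`rfl` ×5): `η`, `k`, `Ω`, `Λ = Λs k`, `U₀`. [cite: Balaban1985RegularSpaces, (1.3)–(1.5) p.77 (bookkeeping)] -/
theorem IdxB8LanC.toZdLanIdx_fields (a : IdxB8LanC θ) :
    a.toZdLanIdx.η = a.mem.1.1.1.1.η ∧ a.toZdLanIdx.k = a.mem.1.1.1.1.k ∧ a.toZdLanIdx.Ω = a.mem.1.1.1.1.Ω ∧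
      a.toZdLanIdx.Λ = a.mem.1.1.1.1.Λs a.mem.1.1.1.1.k ∧ a.toZdLanIdx.U₀ = a.U₀ :=
  ⟨rfl, rfl, rfl, rfl, rfl⟩

/-- The reading of the index built from raw data `(i, hΩ0, hlaws, hdom, hlam, U₀, hU₀)` IS `⟨i.η, i.hη, i.k, i.hk, i.Ω, i.Λs i.k, U₀, hU₀⟩` (`rfl`) — the letter of dag-n05-d's
certificate. [cite: Balaban1985RegularSpaces, (1.3)–(1.5) p.77, Prop. 5 p.94 (bookkeeping)] -/
theorem IdxB8LanC.toZdLanIdx_mk (i : ZdIdx θ.D θ.L) (hΩ0 : i.Ω 0 = Set.univ) (hlaws : IdxB8LawsB θ.L i) (hdom : DomainSeq θ.L i.Ω)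
    (hlam : ∀ l, l < i.k → ∀ z ∈ i.Λs i.k l, ((θ.L : ℤ) ^ l) • z ∈ Lam θ.L i.Ω l)
    (U₀ : B7Prop1Explicit.Site θ.D → Fin θ.D → θ.𝔸ˣ) (hU₀ : ∀ x κ, U₀ x κ ∈ unitaryUnits θ.𝔸) :
    (IdxB8LanC.mk (θ := θ) ⟨⟨⟨⟨i, hΩ0⟩, hlaws⟩, hdom⟩, hlam⟩ U₀ hU₀).toZdLanIdx = ⟨i.η, i.hη, i.k, i.hk, i.Ω, i.Λs i.k, U₀, hU₀⟩ := rfl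

/-- `ι`-LAW FACE `hΩ0L` (the letter of p606531 ∕ p609803's binder): every member of the index has `Ω₀ = ℤᵈ`. [cite: Balaban1985RegularSpaces, p.77 («we admit … Ω_j = T_η»)] -/
theorem IdxB8LanC.hΩ0L (a : IdxB8LanC θ) : a.toZdLanIdx.Ω 0 = Set.univ :=
  a.mem.1.1.1.2

/-- `ι`-LAW FACE `hΩL` (the letter of the knits' binder): the domain sequence is decreasing. [cite: Balaban1985RegularSpaces, (1.3) p.77] -/
theorem IdxB8LanC.hΩL (a : IdxB8LanC θ) : ∀ j, a.toZdLanIdx.Ω (j + 1) ⊆ a.toZdLanIdx.Ω j :=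
  a.mem.1.1.1.1.hΩ

/-- `ι`-LAW FACE `htowerL` (the letter of the knits' binder): the big blocks over the top constraint sets lie in the domains, «`Bʲ(Λ_j) ⊂ Ω_j`».
[cite: Balaban1985RegularSpaces, (1.5) p.77, (1.28)–(1.29) p.81] -/
theorem IdxB8LanC.htowerL (a : IdxB8LanC θ) :
    ∀ j, j ≤ a.toZdLanIdx.k → ∀ y ∈ a.toZdLanIdx.Λ j, ∀ x, InBox (tlo θ.L y j) (thi θ.L y j) x → x ∈ a.toZdLanIdx.Ω j :=
  a.mem.1.1.1.1.htower

/-- The member's four located laws (n05-c's `IdxB8LawsB`), read at the index of record. [cite: Balaban1985RegularSpaces, (1.5)–(1.6) p.77, p.98] -/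
theorem IdxB8LanC.lawsB (a : IdxB8LanC θ) : IdxB8LawsB θ.L a.mem.1.1.1.1 :=
  a.mem.1.1.2

/-- The member's (1.3)–(1.4) domain law (`DomainSeq`), read at the index of record — the reading's `Ω` IS the member's. [cite: Balaban1985RegularSpaces, (1.3)–(1.4) p.77] -/
theorem IdxB8LanC.domainSeq (a : IdxB8LanC θ) : DomainSeq θ.L a.toZdLanIdx.Ω :=
  a.mem.1.2

/-- `ι`-LAW FACE (1.5) (dag-n05-c's repair letter, the member hypothesis the re-keyed letters binders carry): the reading's constraint family `Λ = Λs k` puts every label of level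
`l < k` at a corner in print's layer `Λ_l = Ω_l^{(l)} ∖ Ω_{l+1}^{(l)}`. [cite: Balaban1985RegularSpaces, (1.5) p.77] -/
theorem IdxB8LanC.hlamTop (a : IdxB8LanC θ) :
    ∀ l, l < a.toZdLanIdx.k → ∀ z ∈ a.toZdLanIdx.Λ l, ((θ.L : ℤ) ^ l) • z ∈ Lam θ.L a.toZdLanIdx.Ω l :=
  a.mem.2

variable (θ)

/-- **PROPOSITION 5's MEMBERS OF RECORD** with constant `B₁`: member `a ↦` dag-n05-b's `zdLan θ.L B₁ a.toZdLanIdx` — the Landau-gauge problem (1.107) at the background `a.U₀`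
over the geometry of `a.mem`, hypotheses (1.33) ∧ (1.69) ∧ (1.68) ∧ (1.73)–(1.74) with `B₁`, the norm (1.102), print's family p. 94 and nothing narrower.
[cite: Balaban1985RegularSpaces, Prop. 5 (1.107)–(1.109) p.94, (1.68)–(1.69) p.88, (1.73)–(1.74) pp.88–89, (1.102) p.93, (1.33) p.82] -/
def lanOfRecordSubC (B₁ : ℝ) : IdxB8LanC θ → B8.LandauData :=
  fun a => zdLan θ.L B₁ a.toZdLanIdx

/-- The member of record unfolded (`rfl`). [cite: Balaban1985RegularSpaces, Prop. 5 p.94 (bookkeeping)] -/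
theorem lanOfRecordSubC_apply (B₁ : ℝ) (a : IdxB8LanC θ) : lanOfRecordSubC θ B₁ a = zdLan θ.L B₁ a.toZdLanIdx := rfl

end IndexP5

/-! ## §2. The pinned cut layer `ResidB8.cutSubBP₅`; field faces; honesty both ways -/

section CutP5

variable {θ : Stage3Params}

/-- **THE P₅-PINNED CUT RESIDUAL LAYER**: dag-n05-e's print-class cut `λ.cutSubBP J lan c₁ ρ₀` (Prop. 6's members the print cubes `zdCubP … ρ₀` over the four-law sub-index,
threshold `c₁`) with Proposition 5's carriers PINNED to print's family — index `IdxB8LanC θ`, members `fun a => zdLan θ.L λ.B₁ a.toZdLanIdx` (Prop. 5's constant `B₁` = the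
layer's Thm-2 constant `λ.B₁`, as in the knits of record).  LITERALLY the knits' layer `λ.cutSubBP J (fun a => zdLan θ.L λ.B₁ (ι a)) c₁ ρ₀` at `J := IdxB8LanC θ`,
`ι := IdxB8LanC.toZdLanIdx`. [cite: Balaban1985RegularSpaces, Prop. 5 p.94, Prop. 6 p.99, Thm 2 p.83 («There exist constants B₁, B₂(β₀), c₁») (objects of record)] -/
def ResidB8.cutSubBP₅ (lam : ResidB8 θ) (c₁ : ℝ) (ρ₀ : ℕ) : ResidB8 θ :=
  lam.cutSubBP (IdxB8LanC θ) (fun a => zdLan θ.L lam.B₁ a.toZdLanIdx) c₁ ρ₀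

/-- Unfolding (`rfl`): the pinned layer IS the generic print-class cut at `(IdxB8LanC θ, fun a => zdLan θ.L λ.B₁ a.toZdLanIdx)`.
[cite: Balaban1985RegularSpaces, Prop. 5 p.94 (bookkeeping)] -/
theorem ResidB8.cutSubBP₅_eq_cutSubBP (lam : ResidB8 θ) (c₁ : ℝ) (ρ₀ : ℕ) :
    lam.cutSubBP₅ c₁ ρ₀ = lam.cutSubBP (IdxB8LanC θ) (fun a => zdLan θ.L lam.B₁ a.toZdLanIdx) c₁ ρ₀ := rfl

/-- Proposition 5's index at the pin IS the index of record `IdxB8LanC θ` (`rfl`). [cite: Balaban1985RegularSpaces, Prop. 5 p.94 (bookkeeping)] -/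
theorem ResidB8.cutSubBP₅_I8c (lam : ResidB8 θ) (c₁ : ℝ) (ρ₀ : ℕ) : (lam.cutSubBP₅ c₁ ρ₀).I8c = IdxB8LanC θ := rfl

/-- Proposition 5's members at the pin ARE the members of record at `B₁ := λ.B₁` (`rfl`). [cite: Balaban1985RegularSpaces, Prop. 5 p.94 (bookkeeping)] -/
theorem ResidB8.cutSubBP₅_lan (lam : ResidB8 θ) (c₁ : ℝ) (ρ₀ : ℕ) : (lam.cutSubBP₅ c₁ ρ₀).lan = lanOfRecordSubC θ lam.B₁ := rfl

/-- **HONESTY (no junk member)**: EVERY Proposition-5 member of the pinned layer is print's datum `zdLan θ.L λ.B₁ ⟨η, k, Ω, Λ_k, U₀⟩` at an admissible collar-law member and a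
unitary background (`rfl`). [cite: Balaban1985RegularSpaces, Prop. 5 p.94 («for `U₀ ∈ 𝔄_k({Ω_j}, α₀)`»)] -/
theorem ResidB8.cutSubBP₅_lan_apply (lam : ResidB8 θ) (c₁ : ℝ) (ρ₀ : ℕ) (a : IdxB8LanC θ) :
    (lam.cutSubBP₅ c₁ ρ₀).lan a =
      zdLan θ.L lam.B₁ ⟨a.mem.1.1.1.1.η, a.mem.1.1.1.1.hη, a.mem.1.1.1.1.k, a.mem.1.1.1.1.hk, a.mem.1.1.1.1.Ω, a.mem.1.1.1.1.Λs a.mem.1.1.1.1.k, a.U₀, a.hU₀⟩ := rfl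

/-- ★ **HONESTY (every honest datum is a member)** — dag-n05-d g12's E4 certificate text with the (1.5) law added, here by `rfl`: for EVERY `Ω₀ = ℤᵈ` four-law member `i` obeying
(1.3)–(1.4) AND print's (1.5) on its top family, and EVERY unitary background `U₀`, print's Proposition-5 datum `zdLan θ.L λ.B₁ ⟨i.η, i.hη, i.k, i.hk, i.Ω, i.Λs i.k, U₀, hU₀⟩` IS a Proposition-5 member of the pinned layer.
[cite: Balaban1985RegularSpaces, Prop. 5 p.94, (1.3)–(1.5) p.77] -/
theorem ResidB8.exists_mem_cutSubBP₅_lan_eq_zdLan (lam : ResidB8 θ) (c₁ : ℝ) (ρ₀ : ℕ) (i : ZdIdx θ.D θ.L)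
    (U₀ : B7Prop1Explicit.Site θ.D → Fin θ.D → θ.𝔸ˣ) (hU₀ : ∀ x κ, U₀ x κ ∈ unitaryUnits θ.𝔸)
    (hΩ0 : i.Ω 0 = Set.univ) (hlaws : IdxB8LawsB θ.L i) (hdom : DomainSeq θ.L i.Ω)
    (hlam : ∀ l, l < i.k → ∀ z ∈ i.Λs i.k l, ((θ.L : ℤ) ^ l) • z ∈ Lam θ.L i.Ω l) :
    ∃ a : (lam.cutSubBP₅ c₁ ρ₀).I8c, (lam.cutSubBP₅ c₁ ρ₀).lan a = zdLan θ.L lam.B₁ ⟨i.η, i.hη, i.k, i.hk, i.Ω, i.Λs i.k, U₀, hU₀⟩ :=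
  ⟨IdxB8LanC.mk ⟨⟨⟨⟨i, hΩ0⟩, hlaws⟩, hdom⟩, hlam⟩ U₀ hU₀, rfl⟩

/-- Proposition 6's index and members at the pin are dag-n05-e's print-class ones (`rfl` ×2): the four-law sub-index and the print cubes at `ρ₀`.
[cite: Balaban1985RegularSpaces, Prop. 6 p.99, p.98 (bookkeeping)] -/
theorem ResidB8.cutSubBP₅_I8d_cub (lam : ResidB8 θ) (c₁ : ℝ) (ρ₀ : ℕ) :
    (lam.cutSubBP₅ c₁ ρ₀).I8d = IdxB8SubB θ ∧ (lam.cutSubBP₅ c₁ ρ₀).cub = (fun j : IdxB8SubB θ => zdCubP θ.𝔸 θ.L ρ₀ j.1.1) :=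
  ⟨rfl, rfl⟩

/-- The threshold at the pin is `c₁`; the Hölder data, the [B9] inputs, the shared constants and Proposition 7's axial map are the layer's own (`rfl` ×10).
[cite: Balaban1985RegularSpaces, Thm 2 p.83, Prop. 3 p.87, Thm 4 p.88, Prop. 7 p.100 (bookkeeping)] -/
theorem ResidB8.cutSubBP₅_consts (lam : ResidB8 θ) (c₁ : ℝ) (ρ₀ : ℕ) :
    (lam.cutSubBP₅ c₁ ρ₀).c₁ = c₁ ∧ (lam.cutSubBP₅ c₁ ρ₀).β = lam.β ∧ (lam.cutSubBP₅ c₁ ρ₀).len = lam.len ∧ (lam.cutSubBP₅ c₁ ρ₀).inp = lam.inp ∧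
      (lam.cutSubBP₅ c₁ ρ₀).C₂ = lam.C₂ ∧ (lam.cutSubBP₅ c₁ ρ₀).B₁' = lam.B₁' ∧ (lam.cutSubBP₅ c₁ ρ₀).B₁ = lam.B₁ ∧ (lam.cutSubBP₅ c₁ ρ₀).B₂ = lam.B₂ ∧
      (lam.cutSubBP₅ c₁ ρ₀).B₀β = lam.B₀β ∧ (lam.cutSubBP₅ c₁ ρ₀).toAxial = lam.toAxial :=
  ⟨rfl, rfl, rfl, rfl, rfl, rfl, rfl, rfl, rfl, rfl⟩

/-- Non-vacuity of BOTH located indices at the pin: Proposition 5's (`nonempty_idxB8LanC`) and Proposition 6's (n05-c's `nonempty_idxB8SubB`) — neither conjunct ranges over an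
empty type. [cite: Balaban1985RegularSpaces, Prop. 5 p.94, Prop. 6 p.99 (bookkeeping)] -/
theorem ResidB8.nonempty_cutSubBP₅_I8c_I8d (lam : ResidB8 θ) (c₁ : ℝ) (ρ₀ : ℕ) :
    Nonempty (lam.cutSubBP₅ c₁ ρ₀).I8c ∧ Nonempty (lam.cutSubBP₅ c₁ ρ₀).I8d :=
  ⟨nonempty_idxB8LanC θ, B8IdxB8LawsB.nonempty_idxB8SubB θ⟩

end CutP5

/-! ## §3. The «P₂D» slot `B8LeafOfRecordSubBP₂D` (`Node00/CarriersB8SubBP2D`) at the pin: transfer from the generic cut, the reading, Prop. 5's conjuncts member by member, the eight-binder constructor -/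

section SlotAtP5

variable {θ : Stage3Params}

/-- **TRANSFER** (`Iff.rfl`): the slot at the pin IS the slot at the generic print-class cut `λ.cutSubBP J (fun a => zdLan θ.L λ.B₁ (ι a)) c₁ ρ₀` for `J := IdxB8LanC θ`,
`ι := IdxB8LanC.toZdLanIdx` — so every knit concluding at the generic cut for `(J, ι)` with the `ι`-law binders `hΩ0L ∕ hΩL ∕ htowerL` instantiates at the pin with §1's faces.
[cite: Balaban1985RegularSpaces, Lemma 1 – Thm 8 pp.79–101 (bookkeeping)] -/
theorem b8LeafOfRecordSubBP₂D_cutSubBP₅_iff_cutSubBP (lam : ResidB8 θ) (c₁ : ℝ) (ρ₀ : ℕ) :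
    B8LeafOfRecordSubBP₂D θ (lam.cutSubBP₅ c₁ ρ₀) ↔
      B8LeafOfRecordSubBP₂D θ (lam.cutSubBP (IdxB8LanC θ) (fun a => zdLan θ.L lam.B₁ a.toZdLanIdx) c₁ ρ₀) :=
  Iff.rfl

/-- **THE SLOT AT THE PIN READS** (`Iff.rfl`): the `B8LeafRSC` leaf at `c₇OfRecord θ` over the δ₂-members, Proposition 5 at the MEMBERS OF RECORD `lanOfRecordSubC θ λ.B₁`,
Proposition 6 at the print cubes `zdCubP … ρ₀`, print's axial map, threshold `c₁`. [cite: Balaban1985RegularSpaces, Lemma 1 – Thm 8 pp.79–101 (bookkeeping)] -/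
theorem b8LeafOfRecordSubBP₂D_cutSubBP₅_iff (lam : ResidB8 θ) (c₁ : ℝ) (ρ₀ : ℕ) :
    B8LeafOfRecordSubBP₂D θ (lam.cutSubBP₅ c₁ ρ₀) ↔
      B8LeafRSC θ.D (θ.L : ℝ) lam.C₂ lam.B₁' lam.inp.B₀' lam.B₁ lam.B₂ c₁ lam.inp lam.B₀β (c₇OfRecord θ) (blockPairNA θ.D θ.L θ.𝔸)
        (fun j : IdxB8SubD θ => famB8OfRecordSubBP₂D θ lam.β lam.len j) (lanOfRecordSubC θ lam.B₁) (fun j : IdxB8SubB θ => zdCubP θ.𝔸 θ.L ρ₀ j.1.1)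
        (fun j => toAxialTowerResid θ lam.β lam.len j.1.1.1) :=
  Iff.rfl

/-- **THE SLOT AT THE PIN, READ CONJUNCT BY CONJUNCT**: «Lemma 1 ∧ Prop 5 (∃ ∕ !) OVER PRINT'S FAMILY `lanOfRecordSubC θ λ.B₁` ∧ Prop 6 at the print cubes» ∧ «Thm 2 ∕ Prop 3 ∕ Thm 4
at the δ₂-members ∧ Prop 7 (repaired currency, print's map) ∧ Thm 8 surviving at γ = 1». [cite: Balaban1985RegularSpaces, Lemma 1 p.79, Thm 2 p.83, Prop. 3 p.87, Thm 4 p.88, Prop. 5 p.94, Prop. 6 p.99, Prop. 7 p.100, Thm 8 (1.146) p.101] -/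
theorem b8LeafOfRecordSubBP₂D_cutSubBP₅_iff_classFree_and_P₂D (lam : ResidB8 θ) (c₁ : ℝ) (ρ₀ : ℕ) :
    B8LeafOfRecordSubBP₂D θ (lam.cutSubBP₅ c₁ ρ₀) ↔
      (B8.Lemma1Printed θ.D (blockPairNA θ.D θ.L θ.𝔸) ∧
        B8.Prop5Exists lam.inp.B₀' lam.B₁ (lanOfRecordSubC θ lam.B₁) ∧ B8.Prop5Unique (lanOfRecordSubC θ lam.B₁) ∧
        B8.Prop6Printed θ.D (θ.L : ℝ) lam.B₁ c₁ (fun j : IdxB8SubB θ => zdCubP θ.𝔸 θ.L ρ₀ j.1.1)) ∧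
      (B8.Thm2Printed (fun j : IdxB8SubD θ => (zdGF3P₂ θ.𝔸 θ.L lam.β lam.len j.1.1.1.1).toGFData) ∧
        B8.Prop3Printed θ.D (θ.L : ℝ) lam.C₂ lam.inp lam.B₀β (fun j : IdxB8SubD θ => (zdGF3P₂ θ.𝔸 θ.L lam.β lam.len j.1.1.1.1).toGFData2) ∧
        B8.Thm4Printed lam.B₁' (fun j : IdxB8SubD θ => (zdGF3P₂ θ.𝔸 θ.L lam.β lam.len j.1.1.1.1).toGFData) ∧
        B8Ineq145.Prop7RepairedC (c₇OfRecord θ) (fun j : IdxB8SubD θ => famB8OfRecordSubBP₂D θ lam.β lam.len j) (fun j => toAxialTowerResid θ lam.β lam.len j.1.1.1) ∧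
        B8Thm8Surviving.Thm8SurvivingAt 1 lam.B₁ lam.B₂ (fun j : IdxB8SubD θ => famB8OfRecordSubBP₂D θ lam.β lam.len j)) :=
  b8LeafOfRecordSubBP₂D_iff_classFree_and_P₂D (lam.cutSubBP₅ c₁ ρ₀)

/-- **PROPOSITION 5's TWO CONJUNCTS AT THE PIN ARE PRINT'S SENTENCES, member by member** (`Iff.rfl` ×2 after unfolding the member of record): existence (1.108) with the bound
`8B₀′B₁(α₀+α₁)` and uniqueness (1.109), each quantified over EVERY admissible collar-law member and EVERY unitary background, at dag-n05-b's datum `zdLan θ.L λ.B₁ a.toZdLanIdx`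
(whose `Hyp169 ∕ Solves ∕ lamNorm` are (1.33) ∧ (1.69) ∧ (1.68) ∧ (1.73)–(1.74) ∕ (1.107) ∕ (1.102) by `zdLan_hyp169_iff ∕ zdLan_solves_iff`).
[cite: Balaban1985RegularSpaces, Prop. 5 (1.107)–(1.109) p.94] -/
theorem prop5_cutSubBP₅_reads (lam : ResidB8 θ) (c₁ : ℝ) (ρ₀ : ℕ) :
    (B8.Prop5Exists (lam.cutSubBP₅ c₁ ρ₀).inp.B₀' (lam.cutSubBP₅ c₁ ρ₀).B₁ (lam.cutSubBP₅ c₁ ρ₀).lan ↔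
        ∃ c₂ : ℝ, 0 < c₂ ∧ ∀ a : IdxB8LanC θ, ∀ α₀ α₁ : ℝ, 0 < α₀ → 0 < α₁ → α₀ + α₁ ≤ c₂ →
          ∀ U₁ : (zdLan θ.L lam.B₁ a.toZdLanIdx).Cfg, (zdLan θ.L lam.B₁ a.toZdLanIdx).Hyp169 α₀ α₁ U₁ →
            ∃ l : (zdLan θ.L lam.B₁ a.toZdLanIdx).Lam, (zdLan θ.L lam.B₁ a.toZdLanIdx).Solves U₁ l ∧
              (zdLan θ.L lam.B₁ a.toZdLanIdx).lamNorm l < 8 * lam.inp.B₀' * lam.B₁ * (α₀ + α₁)) ∧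
    (B8.Prop5Unique (lam.cutSubBP₅ c₁ ρ₀).lan ↔
        ∃ c₂ c₃ : ℝ, 0 < c₂ ∧ 0 < c₃ ∧ ∀ a : IdxB8LanC θ, ∀ α₀ α₁ : ℝ, 0 < α₀ → 0 < α₁ → α₀ + α₁ ≤ c₂ →
          ∀ U₁ : (zdLan θ.L lam.B₁ a.toZdLanIdx).Cfg, (zdLan θ.L lam.B₁ a.toZdLanIdx).Hyp169 α₀ α₁ U₁ →
            ∀ l₁ l₂ : (zdLan θ.L lam.B₁ a.toZdLanIdx).Lam, (zdLan θ.L lam.B₁ a.toZdLanIdx).Solves U₁ l₁ → (zdLan θ.L lam.B₁ a.toZdLanIdx).Solves U₁ l₂ →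
              (zdLan θ.L lam.B₁ a.toZdLanIdx).lamNorm l₁ < c₃ → (zdLan θ.L lam.B₁ a.toZdLanIdx).lamNorm l₂ < c₃ → l₁ = l₂) :=
  ⟨Iff.rfl, Iff.rfl⟩

/-- **THE SLOT AT THE PIN FROM EIGHT BINDERS** (Proposition 7 in the repaired currency SUPPLIED inside by `prop7_famB8OfRecordSubBP₂D`, `2 ≤ θ.D`): Lemma 1, Thm 2 ∕ Prop 3 ∕ Thm 4
at the δ₂-members, Proposition 5 (∃ ∕ !) OVER PRINT'S FAMILY `lanOfRecordSubC θ λ.B₁`, Proposition 6 at the print cubes, Thm 8 surviving.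
[cite: Balaban1985RegularSpaces, Lemma 1 – Thm 8 pp.79–101, Prop. 5 p.94, Prop. 7 (1.145) p.100] -/
theorem b8LeafOfRecordSubBP₂D_cutSubBP₅_of_fields (hD : 2 ≤ θ.D) (lam : ResidB8 θ) (c₁ : ℝ) (ρ₀ : ℕ)
    (l1 : B8.Lemma1Printed θ.D (blockPairNA θ.D θ.L θ.𝔸))
    (t2 : B8.Thm2Printed (fun j : IdxB8SubD θ => (zdGF3P₂ θ.𝔸 θ.L lam.β lam.len j.1.1.1.1).toGFData))
    (p3 : B8.Prop3Printed θ.D (θ.L : ℝ) lam.C₂ lam.inp lam.B₀β (fun j : IdxB8SubD θ => (zdGF3P₂ θ.𝔸 θ.L lam.β lam.len j.1.1.1.1).toGFData2))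
    (t4 : B8.Thm4Printed lam.B₁' (fun j : IdxB8SubD θ => (zdGF3P₂ θ.𝔸 θ.L lam.β lam.len j.1.1.1.1).toGFData))
    (p5e : B8.Prop5Exists lam.inp.B₀' lam.B₁ (lanOfRecordSubC θ lam.B₁)) (p5u : B8.Prop5Unique (lanOfRecordSubC θ lam.B₁))
    (p6 : B8.Prop6Printed θ.D (θ.L : ℝ) lam.B₁ c₁ (fun j : IdxB8SubB θ => zdCubP θ.𝔸 θ.L ρ₀ j.1.1))
    (t8 : B8Thm8Surviving.Thm8SurvivingAt 1 lam.B₁ lam.B₂ (fun j : IdxB8SubD θ => famB8OfRecordSubBP₂D θ lam.β lam.len j)) :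
    B8LeafOfRecordSubBP₂D θ (lam.cutSubBP₅ c₁ ρ₀) :=
  b8LeafOfRecordSubBP₂D_of_fields hD (lam.cutSubBP₅ c₁ ρ₀) l1 t2 p3 t4 p5e p5u p6 t8

end SlotAtP5

end Literature.MathematicalPhysics.QuantumFieldTheory.Balaban1983to89.Node00

end
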